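import Summits.QuantumFields.BalabanUV.T4Continuum.Support.NE3FrameGenLocal
import HarnessLib

/-!
# T⁴ programme, node NE3 — route Π, row Π-R (curved step), file Π-R-W6b: THE ℓ² LETTER (R1) OF THE EXACT CURVED RIGHT INVERSE —
# `dirSq (rightInvW … φ) (periodBox (N·L^{k+1})) ≤ l2C(d,L)∕(1 − θ_loc)² · (L^{k+1})^d∕(L^{k+1})² · dirSq φ (periodBox N)`, k-FREE, N-FREE

NE3 (node U1b) formalisation swarm, leaf seat `b2b-balaban-t4-ne3-formalise-leaf-01` (gen 8); row Π-R-W, letter (R1) of ruling ρ-g25-1 (2) in the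
currency of the owner's file 4 (`NE3DecomposedRepOfShapes.decomposedRep_of_shapes`, hypothesis `hR1`): fine box `periodBox (N * L^(k+1))`, coarse box
`periodBox N`, weight `(L^{k+1})^d ∕ (L^{k+1})²`.  THE THREE PIECES.  (i) the transported lift `covLift` is an isometric copy of the flat smooth lift
(W3 `norm_covLift_eq`) whose torus ℓ² is Π-R♭-4a's `NE3SmoothLiftBounds.sum_normSq_smoothLift_le` (`liftC²·M^d∕M²`); (ii) the covariant corrector
`gaugeDir W (tinterpW M W (−G))` in ℓ² is gen-6's `NE3CovariantTentInterpolantEnergy.sum_normSq_gaugeDir_tinterpW_le` (coarse field `U = cavgIter L (k+1) W`,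
`δ = 8·loopRad(x_k)`), its two sums bounded by W6b¹ (`sum_normSq_gaugeDir_le`, `sum_normSq_frameGen_le`: the generator `G = frameGen` is LOCAL), and
its coefficient `Kt·M² ≤ ktC(d)` under the regime letter `(L^{k+1})²·x ≤ 1` (W6a `kt_mul_sq_le`); (iii) the solve in ℓ²
(W6b⁰ `dirSq_solve_le`, binder `thetaLoc·(L^{k+1})²·x < 1`).  ENDs: **`dirSq_hatInvW_le`** (the unsolved operator on a generic periodic coarse field —
the form leaf-02-g8's curl letters pair with) and **`dirSq_rightInvW_le`** (R1).

CONTENT ([folklore]; 0 sorry; DATA defs `corr2C`, `l2C` — explicit; `ktC` is W6a's): §2 the corrector in ℓ²; §3 the lift in ℓ²;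
§4 `dirSq_hatInvW_le`; §5 `dirSq_rightInvW_le`.

HONEST FRAMING.  Kinematics of OUR objects; constants explicit and crude; (R2)–(R4),(R6′) are separate files (curl: leaf-02-g8; ℓ¹: W6d); nothing about
minimisers; (P♮)_W, T-E_w and **NE3 are NOT proved**; spine PROVED 0∕9; finite T⁴ rung (B)+1 — NOT infinite volume, NOT mass gap, NOT `BetaPertH`,
NOT Clay.  PLACEMENT: `Summits/QuantumFields/BalabanUV/`.  HONEST DEPENDENCY (cell page 1): continuum YM on T⁴ ⇐ BetaPertH ∧ nine spine estimates
(0/9 proved); BetaPertH ⇐ (D1) ∧ (D4) ∧ CAP+tail; G-an2-4 gates asym, D1 and NE2/3/4.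
-/

set_option autoImplicit false

open scoped BigOperators Matrix.Norms.L2Operator
open Finset

namespace Summit.QuantumFields.BalabanUV.T4Continuum.NE3RightInverseL2Letter

open Literature.MathematicalPhysics.QuantumFieldTheory.Balaban1983to89
open B7Prop1Explicit B7Prop2Explicit
open T4AveragingDeficitWall (IsUnitaryCfg IsSkewDir SmallField dirSq)
open T4AveragingDeficitWallBoundary (IsPeriodicCfg periodBox)
open AveragingDeficitPeriodicCounting (IsPeriodicDir)
open AveragingDeficitMultiLevelPrep (cavgIter LevelSmall tower cavgIter_unitary_small isPeriodicCfg_cavgIter)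
open AveragingDeficitTwoLevelPrep (prop1Radius skewSub)
open AveragingDeficitTorusChart (TDir extDir isPeriodicDir_extDir)
open AveragingDeficitBlockDensity (bseg)
open SpreadLift (loopRad)
open BlockAveragePushDirGauge (gaugeDir)
open NE3CovariantTentInterpolant (tinterpW)
open NE3CovariantTentInterpolantEnergy (sum_normSq_gaugeDir_tinterpW_le)
open NE3TowerBondVsSegment (norm_cavgIter_sub_bseg_le_top)
open NE3TopRadiusLetters (loopRad_iterate_le_of_levelSmall)
open NE3SmoothLiftBounds (sum_normSq_smoothLift_le)
open NE3CovariantLift (covLift hatInvW frameGen norm_covLift_eq frameGen_add_period)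
open NE3QbarIterCovLiftPrep (liftC cruxC liftC_nonneg)
open NE3SmoothRightInverseW (solveW resSkew rightInvW)
open NE3RightInverseSupLetters (frameC ktC ktC_nonneg kt_mul_sq_le)
open NE3RightInverseSolveLetters (l1Ball card_l1Ball_le thetaLoc dirSq_solve_le)
open NE3FrameGenLocal (frameRad sum_normSq_frameGen_le sum_normSq_gaugeDir_le)

noncomputable section

variable {d : ℕ} {n : Type*} [Fintype n] [DecidableEq n]

/-! ## §2 The covariant corrector in ℓ²(fine torus) -/

/-- THE CORRECTOR ℓ² CONSTANT: `corr2C = 2^{d+1}·4d + d·2^d·ktC`. [folklore] -/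
def corr2C (d : ℕ) : ℝ := (2 : ℝ) ^ (d + 1) * (4 * d) + d * (2 : ℝ) ^ d * ktC d

/-- `0 ≤ corr2C`. [folklore] -/
theorem corr2C_nonneg (d : ℕ) : 0 ≤ corr2C d := by unfold corr2C; have := ktC_nonneg d; positivity

/-- **THE COVARIANT CORRECTOR IN ℓ²** (`L ≥ 2`, class, `W` of period `L^{k+1}·N`, regime `(L^{k+1})²x ≤ 1`, `N`-periodic generator `m`):
`Σ_{y∈periodBox(M·N)} Σ_α ‖gaugeDir W (tinterpW M W m) y α‖² ≤ corr2C·(M^d∕M²)·Σ_{z∈periodBox N}‖m z‖²`, `M = L^{k+1}`. [folklore] -/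
theorem sum_normSq_corrector_le [Nonempty n] {L : ℕ} (hL : 2 ≤ L) (k : ℕ) {N : ℕ} [NeZero N] {W : Site d → Fin d → (Matrix n n ℂ)ˣ} {x : ℝ}
    (hWu : IsUnitaryCfg W) (hWP : IsPeriodicCfg W ((tower L N (k + 1) : ℕ) : ℤ)) (hx : 0 ≤ x) (hs : LevelSmall d L k x) (hWx : SmallField W x)
    (hε : ((L : ℝ) ^ (k + 1)) ^ 2 * x ≤ 1) {m : Site d → Matrix n n ℂ} (hm : ∀ (z : Site d) (τ : Fin d), m (z + (N : ℤ) • e τ) = m z) :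
    ∑ y ∈ periodBox (d := d) (L ^ (k + 1) * N), ∑ α : Fin d, ‖gaugeDir W (tinterpW (L ^ (k + 1)) W m) y α‖ ^ 2
      ≤ corr2C d * (((L : ℝ) ^ (k + 1)) ^ d / ((L : ℝ) ^ (k + 1)) ^ 2) * ∑ z ∈ periodBox (d := d) N, ‖m z‖ ^ 2 := by
  have hL1 : 1 ≤ L := by omega
  have hN1 : 1 ≤ N := Nat.one_le_iff_ne_zero.mpr (NeZero.ne N)
  obtain ⟨M, hM⟩ : ∃ M : ℕ, M = L ^ (k + 1) := ⟨_, rfl⟩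
  have hM1 : 1 ≤ M := by rw [hM]; exact Nat.one_le_pow _ _ (by omega)
  have hMr : ((M : ℕ) : ℝ) = (L : ℝ) ^ (k + 1) := by rw [hM]; push_cast; ring
  have hM0 : (0 : ℝ) < (M : ℝ) := by exact_mod_cast (show 0 < M by omega)
  have hM2 : (0 : ℝ) < (M : ℝ) ^ 2 := by positivity
  rw [← hM, ← hMr]
  obtain ⟨hUu, -, -⟩ := cavgIter_unitary_small hL1 k hWu hx hs hWx
  have hUP : IsPeriodicCfg (cavgIter L (k + 1) W) (N : ℤ) := isPeriodicCfg_cavgIter L N (k + 1) hWP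
  have hδb : ∀ (w : Site d) (β : Fin d), ‖((cavgIter L (k + 1) W w β : (Matrix n n ℂ)ˣ) : Matrix n n ℂ) - bseg M W w β‖
      ≤ 8 * loopRad d L ((prop1Radius d L)^[k] x) := fun w β => by
    rw [hM]; exact norm_cavgIter_sub_bseg_le_top hL k hWu hx hs hWx w β
  have hmain := sum_normSq_gaugeDir_tinterpW_le hM1 hN1 hWu hUu hx hWx hδb hUP hm
  have hg := sum_normSq_gaugeDir_le hUu hN1 hm
  have hkt := kt_mul_sq_le (d := d) hL k hx hs hMr hε
  set Kt : ℝ := 8 * ((d : ℝ) * M * x) ^ 2 + (16 / (M : ℝ) ^ 2) * (8 * loopRad d L ((prop1Radius d L)^[k] x) + 9 * (d : ℝ) ^ 2 * (M : ℝ) ^ 2 * x) ^ 2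
    with hKt
  set S : ℝ := ∑ z ∈ periodBox (d := d) N, ‖m z‖ ^ 2 with hS
  have hS0 : 0 ≤ S := Finset.sum_nonneg fun _ _ => sq_nonneg _
  have hK0 : 0 ≤ Kt := by rw [hKt]; positivity
  have hMd : 0 ≤ (M : ℝ) ^ d / (M : ℝ) ^ 2 := by positivity
  refine hmain.trans ?_
  -- first term: the gauge directions of `m` at the coarse field; second: `M^d·Kt = (M^d∕M²)·(Kt·M²) ≤ (M^d∕M²)·ktC`
  have h1 : (2 : ℝ) ^ (d + 1) * ((M : ℝ) ^ d / (M : ℝ) ^ 2) * ∑ z ∈ periodBox (d := d) N, ∑ α : Fin d, ‖gaugeDir (cavgIter L (k + 1) W) m z α‖ ^ 2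
      ≤ (2 : ℝ) ^ (d + 1) * ((M : ℝ) ^ d / (M : ℝ) ^ 2) * (4 * d * S) := mul_le_mul_of_nonneg_left hg (by positivity)
  have h2 : (d : ℝ) * (2 : ℝ) ^ d * (M : ℝ) ^ d * Kt * S ≤ (d : ℝ) * (2 : ℝ) ^ d * ((M : ℝ) ^ d / (M : ℝ) ^ 2) * ktC d * S := by
    have e : (d : ℝ) * (2 : ℝ) ^ d * (M : ℝ) ^ d * Kt * S = (d : ℝ) * (2 : ℝ) ^ d * ((M : ℝ) ^ d / (M : ℝ) ^ 2) * (Kt * (M : ℝ) ^ 2) * S := by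
      field_simp
    rw [e]
    exact mul_le_mul_of_nonneg_right (mul_le_mul_of_nonneg_left hkt (by positivity)) hS0
  calc (2 : ℝ) ^ (d + 1) * ((M : ℝ) ^ d / (M : ℝ) ^ 2) * ∑ z ∈ periodBox (d := d) N, ∑ α : Fin d, ‖gaugeDir (cavgIter L (k + 1) W) m z α‖ ^ 2
        + (d : ℝ) * (2 : ℝ) ^ d * (M : ℝ) ^ d * Kt * S
      ≤ (2 : ℝ) ^ (d + 1) * ((M : ℝ) ^ d / (M : ℝ) ^ 2) * (4 * d * S) + (d : ℝ) * (2 : ℝ) ^ d * ((M : ℝ) ^ d / (M : ℝ) ^ 2) * ktC d * S :=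
        add_le_add h1 h2
    _ = corr2C d * ((M : ℝ) ^ d / (M : ℝ) ^ 2) * S := by rw [corr2C]; ring

/-! ## §3 The transported lift in ℓ²(fine torus) -/

/-- **THE LIFT IN ℓ²**: `dirSq (covLift M W Φ) (periodBox (M·N)) ≤ liftC²·(M^d∕M²)·dirSq Φ (periodBox N)` (`M ≥ 2`, unitary `W`). [folklore] -/
theorem dirSq_covLift_le {M : ℕ} (hM : 2 ≤ M) (hd : 1 ≤ d) {W : Site d → Fin d → (Matrix n n ℂ)ˣ} (hWu : IsUnitaryCfg W) (N : ℕ)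
    (Φ : Site d → Fin d → Matrix n n ℂ) :
    dirSq (covLift M W Φ) (periodBox (d := d) (M * N)) ≤ liftC d ^ 2 * ((M : ℝ) ^ d / (M : ℝ) ^ 2) * dirSq Φ (periodBox (d := d) N) := by
  unfold dirSq
  have h := sum_normSq_smoothLift_le hM hd N Φ
  simp only [norm_covLift_eq hWu]
  rw [liftC]
  exact h

/-! ## §4 (R1) for the unsolved operator `hatInvW` -/

/-- THE ℓ² CONSTANT: `l2C = 2·liftC² + 2·corr2C·(frameC·liftC)²·(2·frameRad + 1)^d`. [folklore] -/
def l2C (d L : ℕ) : ℝ := 2 * liftC d ^ 2 + 2 * corr2C d * (frameC d L * liftC d) ^ 2 * (2 * (frameRad d L : ℝ) + 1) ^ d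

/-- `0 ≤ l2C`. [folklore] -/
theorem l2C_nonneg (d L : ℕ) : 0 ≤ l2C d L := by
  unfold l2C frameC; have := liftC_nonneg d; have := corr2C_nonneg d; positivity

/-- **(R1) FOR `hatInvW`** (`L ≥ 2`, class, `W` of period `L^{k+1}·N`, regime `(L^{k+1})²x ≤ 1`, `Φ` `N`-periodic):
`dirSq (hatInvW L k W Φ) (periodBox (N·L^{k+1})) ≤ l2C·((L^{k+1})^d∕(L^{k+1})²)·dirSq Φ (periodBox N)`. [folklore] -/
theorem dirSq_hatInvW_le [Nonempty n] {L : ℕ} (hL : 2 ≤ L) (k : ℕ) {N : ℕ} [NeZero N] {W : Site d → Fin d → (Matrix n n ℂ)ˣ} {x : ℝ}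
    (hWu : IsUnitaryCfg W) (hWP : IsPeriodicCfg W ((tower L N (k + 1) : ℕ) : ℤ)) (hx : 0 ≤ x) (hs : LevelSmall d L k x) (hWx : SmallField W x)
    (hε : ((L : ℝ) ^ (k + 1)) ^ 2 * x ≤ 1) {Φ : Site d → Fin d → Matrix n n ℂ} (hΦP : IsPeriodicDir Φ (N : ℤ)) :
    dirSq (hatInvW L k W Φ) (periodBox (d := d) (N * L ^ (k + 1)))
      ≤ l2C d L * (((L : ℝ) ^ (k + 1)) ^ d / ((L : ℝ) ^ (k + 1)) ^ 2) * dirSq Φ (periodBox (d := d) N) := by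
  rcases Nat.eq_zero_or_pos d with hd0 | hd
  · -- `d = 0`: no directions, both sides vanish
    subst hd0
    simp only [dirSq, Finset.univ_eq_empty, Finset.sum_empty, Finset.sum_const_zero, mul_zero, le_refl]
  have hN1 : 1 ≤ N := Nat.one_le_iff_ne_zero.mpr (NeZero.ne N)
  obtain ⟨M, hM⟩ : ∃ M : ℕ, M = L ^ (k + 1) := ⟨_, rfl⟩
  have hM2 : 2 ≤ M := by
    rw [hM]; calc 2 ≤ L := hL
      _ = L ^ 1 := (pow_one L).symm
      _ ≤ L ^ (k + 1) := Nat.pow_le_pow_right (by omega) (by omega)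
  have hMr : ((M : ℕ) : ℝ) = (L : ℝ) ^ (k + 1) := by rw [hM]; push_cast; ring
  -- the generator `m = −G` is `N`-periodic
  have hm : ∀ (z : Site d) (τ : Fin d), (fun w => -frameGen L k W Φ w) (z + (N : ℤ) • e τ) = (fun w => -frameGen L k W Φ w) z := by
    intro z τ; simp only [frameGen_add_period hL k hWP hΦP z τ]
  -- the three pieces
  have hlift := dirSq_covLift_le hM2 hd hWu N Φ
  have hcorr := sum_normSq_corrector_le hL k hWu hWP hx hs hWx hε (m := fun w => -frameGen L k W Φ w) hm
  have hG := sum_normSq_frameGen_le hL k hWu hx hs hWx hN1 hΦP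
  rw [← hM, ← hMr] at hcorr
  rw [← hMr, Nat.mul_comm N, ← hM]
  have hMd : 0 ≤ (M : ℝ) ^ d / (M : ℝ) ^ 2 := by positivity
  have hD0 : 0 ≤ dirSq Φ (periodBox (d := d) N) := by unfold dirSq; positivity
  have hcard : (((l1Ball (frameRad d L) : Finset (Site d))).card : ℝ) ≤ (2 * (frameRad d L : ℝ) + 1) ^ d := by
    exact_mod_cast card_l1Ball_le (d := d) (frameRad d L)
  -- split `‖a + b‖² ≤ 2‖a‖² + 2‖b‖²`
  have hsplit : dirSq (hatInvW L k W Φ) (periodBox (d := d) (M * N))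
      ≤ 2 * dirSq (covLift M W Φ) (periodBox (d := d) (M * N))
        + 2 * ∑ y ∈ periodBox (d := d) (M * N), ∑ α : Fin d, ‖gaugeDir W (tinterpW M W fun w => -frameGen L k W Φ w) y α‖ ^ 2 := by
    unfold dirSq
    rw [Finset.mul_sum, Finset.mul_sum, ← Finset.sum_add_distrib]
    refine Finset.sum_le_sum fun y _ => ?_
    rw [Finset.mul_sum, Finset.mul_sum, ← Finset.sum_add_distrib]
    refine Finset.sum_le_sum fun α _ => ?_
    have h0 := pow_le_pow_left₀ (norm_nonneg _) (norm_add_le (covLift M W Φ y α) (gaugeDir W (tinterpW M W fun w => -frameGen L k W Φ w) y α)) 2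
    have h : ‖covLift M W Φ y α + gaugeDir W (tinterpW M W fun w => -frameGen L k W Φ w) y α‖ ^ 2
        ≤ 2 * ‖covLift M W Φ y α‖ ^ 2 + 2 * ‖gaugeDir W (tinterpW M W fun w => -frameGen L k W Φ w) y α‖ ^ 2 := by
      nlinarith [sq_nonneg (‖covLift M W Φ y α‖ - ‖gaugeDir W (tinterpW M W fun w => -frameGen L k W Φ w) y α‖)]
    simpa only [hatInvW, hM] using h
  have hneg : ∑ z ∈ periodBox (d := d) N, ‖(fun w => -frameGen L k W Φ w) z‖ ^ 2 = ∑ z ∈ periodBox (d := d) N, ‖frameGen L k W Φ z‖ ^ 2 := by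
    simp only [norm_neg]
  rw [hneg] at hcorr
  calc dirSq (hatInvW L k W Φ) (periodBox (d := d) (M * N))
      ≤ 2 * (liftC d ^ 2 * ((M : ℝ) ^ d / (M : ℝ) ^ 2) * dirSq Φ (periodBox (d := d) N))
        + 2 * (corr2C d * ((M : ℝ) ^ d / (M : ℝ) ^ 2)
            * ((frameC d L * liftC d) ^ 2 * ((l1Ball (frameRad d L) : Finset (Site d))).card * dirSq Φ (periodBox (d := d) N))) := by
        refine hsplit.trans (add_le_add (mul_le_mul_of_nonneg_left hlift (by norm_num)) (mul_le_mul_of_nonneg_left ?_ (by norm_num)))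
        exact hcorr.trans (mul_le_mul_of_nonneg_left hG (mul_nonneg (corr2C_nonneg d) hMd))
    _ ≤ l2C d L * ((M : ℝ) ^ d / (M : ℝ) ^ 2) * dirSq Φ (periodBox (d := d) N) := by
        rw [l2C]
        have hc2 := corr2C_nonneg d
        have hfl : 0 ≤ (frameC d L * liftC d) ^ 2 := sq_nonneg _
        have key : corr2C d * ((M : ℝ) ^ d / (M : ℝ) ^ 2) * ((frameC d L * liftC d) ^ 2 * ((l1Ball (frameRad d L) : Finset (Site d))).card
              * dirSq Φ (periodBox (d := d) N))
            ≤ corr2C d * ((M : ℝ) ^ d / (M : ℝ) ^ 2) * ((frameC d L * liftC d) ^ 2 * (2 * (frameRad d L : ℝ) + 1) ^ d * dirSq Φ (periodBox (d := d) N)) :=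
          mul_le_mul_of_nonneg_left (mul_le_mul_of_nonneg_right (mul_le_mul_of_nonneg_left hcard hfl) hD0) (mul_nonneg hc2 hMd)
        nlinarith [key]

/-! ## §5 (R1) for the exact right inverse -/

/-- **THE ℓ² LETTER (R1) OF THE EXACT CURVED RIGHT INVERSE** (`L ≥ 2`, class, `W` of period `L^{k+1}·N`, `θ = cruxC·ε < 1`, `θ_loc = thetaLoc·ε < 1`,
regime `ε = (L^{k+1})²x ≤ 1`, `φ` skew):
`dirSq (rightInvW … φ) (periodBox (N·L^{k+1})) ≤ (l2C ∕ (1 − θ_loc)²)·((L^{k+1})^d∕(L^{k+1})²)·dirSq φ (periodBox N)`. [folklore] -/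
theorem dirSq_rightInvW_le [Nonempty n] {L : ℕ} (hL : 2 ≤ L) (k : ℕ) {N : ℕ} [NeZero N] {W : Site d → Fin d → (Matrix n n ℂ)ˣ} {x : ℝ}
    (hWu : IsUnitaryCfg W) (hWP : IsPeriodicCfg W ((tower L N (k + 1) : ℕ) : ℤ)) (hx : 0 ≤ x) (hs : LevelSmall d L k x) (hWx : SmallField W x)
    (hθ : cruxC d L * (((L : ℝ) ^ (k + 1)) ^ 2 * x) < 1) (hθl : thetaLoc d L * (((L : ℝ) ^ (k + 1)) ^ 2 * x) < 1)
    (hε : ((L : ℝ) ^ (k + 1)) ^ 2 * x ≤ 1) {φ : Site d → Fin d → Matrix n n ℂ} (hφ : IsSkewDir φ) :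
    dirSq (rightInvW hL k hWu hx hs hWx N hθ hφ) (periodBox (d := d) (N * L ^ (k + 1)))
      ≤ (l2C d L / (1 - thetaLoc d L * (((L : ℝ) ^ (k + 1)) ^ 2 * x)) ^ 2) * (((L : ℝ) ^ (k + 1)) ^ d / ((L : ℝ) ^ (k + 1)) ^ 2)
          * dirSq φ (periodBox (d := d) N) := by
  set Φ : Site d → Fin d → Matrix n n ℂ := extDir N ((solveW hL k hWu hx hs hWx N hθ (resSkew N hφ) : ↥(skewSub d n N)) : TDir d n N) with hΦ
  have hΦP : IsPeriodicDir Φ (N : ℤ) := isPeriodicDir_extDir N _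
  have h1 := dirSq_hatInvW_le hL k hWu hWP hx hs hWx hε hΦP
  have h2 := dirSq_solve_le hL k hWu hx hs hWx N hθ hθl hφ
  have hpos : 0 < 1 - thetaLoc d L * (((L : ℝ) ^ (k + 1)) ^ 2 * x) := by linarith
  have hval : rightInvW hL k hWu hx hs hWx N hθ hφ = hatInvW L k W Φ := rfl
  rw [hval]
  refine h1.trans ?_
  have hc : 0 ≤ l2C d L * (((L : ℝ) ^ (k + 1)) ^ d / ((L : ℝ) ^ (k + 1)) ^ 2) := by have := l2C_nonneg d L; positivity
  calc l2C d L * (((L : ℝ) ^ (k + 1)) ^ d / ((L : ℝ) ^ (k + 1)) ^ 2) * dirSq Φ (periodBox (d := d) N)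
      ≤ l2C d L * (((L : ℝ) ^ (k + 1)) ^ d / ((L : ℝ) ^ (k + 1)) ^ 2)
          * (dirSq φ (periodBox (d := d) N) / (1 - thetaLoc d L * (((L : ℝ) ^ (k + 1)) ^ 2 * x)) ^ 2) := mul_le_mul_of_nonneg_left h2 hc
    _ = (l2C d L / (1 - thetaLoc d L * (((L : ℝ) ^ (k + 1)) ^ 2 * x)) ^ 2) * (((L : ℝ) ^ (k + 1)) ^ d / ((L : ℝ) ^ (k + 1)) ^ 2)
          * dirSq φ (periodBox (d := d) N) := by
        field_simp

end

end Summit.QuantumFields.BalabanUV.T4Continuum.NE3RightInverseL2Letter
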